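import Summits.QuantumFields.YangMills.Theorems.ParabolicTrajectoryContinuumLimitOnTrajectoryDefsG

/-!
# Line `two-orbit-synchronisation` — skeleton v3.7 for crux `ContinuumLimitOnTrajectory` (stmt-QuantumFields-10522)

Crux = conjunct (A) of route `ParabolicTrajectory` (rev 4), concluded BY NAME below
(`Summit.QuantumFields.YangMills.Theses.ParabolicTrajectory.ContinuumLimitOnTrajectory`).

Lead `prover-line-stmt-QuantumFields-10522-c5-0` (seat c5; v3.7 = v3.6 + the pre-certified repaired route, §4b). History: v1 = the planner's skeleton; v2 = lead -0's reshape
(`stub_sync` p87541, `stub_anatomy` p87547, `stub_osPackaging` p90720 landed; `stub_chart` PROMOTED); v3–v3.3 = seat c2's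
reshape of the three shared legs into lattice kinematics, ALL LANDED (`stub_axisSymmetry` p115410, `stub_arp` p116117,
`stub_transl` p119243, `stub_uclOfGap` p123780), plus the inputs `IRInputs`/`UVInputs`. Seat c3:
* v3.4 — `TorusSlabRP` DISCHARGED (`torusSlabRP_of_tendsto`, …SlabRP p124885: odd-torus Osterwalder–Seiler positivity +
  `β_k → ∞`); inputs split (…DefsD p124940: `VolumeClause` quarantined, `IRPhysics`, `UVPhysics` without `UVB`); the
  composition LANDED as a tree theorem (…Reduction p125389: `continuumLimitOnTrajectory_of_inputs`).
* v3.5 (seat c3) — two cross-crux findings of the stmt-15828 lead (`ContinuumLegGivenGap`) consumed: (i) the slack-free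
  torus OS gap `TorusOSGap` in `IRPhysics` is UNSATISFIABLE on periodic tori (OS-null two-slice witness), so the IR input is
  re-typed in ε-slack Cauchy–Schwarz currency `IRPhysicsCS` (`QualFiniteSize ∧ ∃ Δ₁ > 0, HasCSClustering r (canon r sch) Δ₁`,
  Literature `ClustersCS`) and the E4 input `UCL` is fed by the landed sibling theorem `stub_uclOfCscl` (p132690) instead of
  `stub_uclOfGap`; (ii) rotation restoration for all of `SO(4)` follows from `UUVB` + ONE Pythagorean rotation (landed
  `stub_rotOfPythagorean` p133709), so the UV input is `UVPhysics345` (`UUVB ∧ Rot345 ∧ ND2 ∧ ND3`). Vocabulary …DefsE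
  (p139718); reduction …Reduction2 (`Reduction.reductionCS`, `continuumLimitWithGap_of_inputsCS`,
  `continuumLimitOnTrajectory_of_inputsCS`). BONUS in this currency: the SAME canonical witness has the continuum gap
  `T.HasMassGap Δ₁` (`ContinuumLimitWithGap`, `continuumLimitWithGap_skeleton` below) — the transfer half of crux (B).

* v3.6 (seat c4) — the misstatement made structural. `VolumeClause` (old hypothesis block ⇒ `PolyVolumeGrowth`)
  stays underivable after ANY restatement of (A) (it speaks about the old block; `…VolumeGlue` does not discharge it), so the
  useful theorem is the PER-SEQUENCE reduction for the restated crux: `…DefsF` types `ContinuumLimitOnTrajectoryPVG` ((A)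
  verbatim + `∃ N ≥ 1, ∀ᶠ k, (a_k)⁻¹ ≤ (a_k L_k)^N` after `HasLatticeMassGap`) and `…ReductionPVG` proves
  `continuumLimitOnTrajectoryPVG_of_inputs : ChartExists → IRPhysicsCS → UVPhysics345 → ContinuumLimitOnTrajectoryPVG` — the
  restated crux closed modulo the chart and the two physics inputs ONLY — and the composition below is
  `continuumLimitOnTrajectory_of_volumeClause stub_volume (continuumLimitOnTrajectoryPVG_of_inputs stub_chart stub_irPhysicsCS
  stub_uvPhysics345)`: crux as typed = quarantined volume stub + restated crux.

* v3.7 (this file, seat c5) — NO change to the registered stubs or to the composition; the seam count was re-derived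
  independently from `latticeSchwinger`/`smearedLatticeField`/`torusLift` (face multiplicity `a_k⁻³`, Schwartz tails, harmless
  for every Schwartz pair iff `PolyVolumeGrowth`) and the verdict *misstated* re-affirmed; `…DefsG` (p144680) pre-certifies the
  REPAIRED ROUTE: `TunedSequenceExistsPVG` ((S) with the clause in its conclusion), `closesPVG : ContinuumLimitOnTrajectoryPVG →
  LatticeGapOnTrajectory → TunedSequenceExistsPVG → YangMills` (the rev-7 `closes` rethreaded), `yangMills_of_inputsPVG`; and
  `…RouteRepair` RECONCILES this chain's repair with the (B) chain's (stmt-10523, `…LatticeGapOnTrajectorySplitDefs`): one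
  volume clause (`PolyVolumeGrowth ⇒ HasVolumeGrowth`), and deciding theorems in GAP CURRENCY — `yangMills_of_gapCurrency :
  ContinuumLimitWithGapPVG → Split.LatticeGapOnTrajectoryLat → TunedSequenceExistsPVG → YangMills` (no transfer clause, no
  reflection symmetry: the canonical one-field witness is not reflection-symmetric, so the (B) chain's restated transfer would
  not apply to it; instead the (A) line delivers the continuum gap of its own witness) and `yangMills_of_allInputs` — §4b below:
  the WHOLE ROUTE is closed modulo the three stubs of `continuumLimitOnTrajectoryPVG_skeleton`, the (B) line's physics stub
  (orbit–Kantorovich windows) and the repaired (S). Terminal status of the chain: `Cruxes/ContinuumLimitOnTrajectory/LEAD-SUMMARY.md`.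

Registered open stubs of v3.7 (4, unchanged statements): `stub_chart` (PROMOTED, planner), `stub_volume` (QUARANTINED misstatement of (A):
hypothesis block ⇒ `PolyVolumeGrowth sch`; restate (A)), `stub_irPhysicsCS` (INPUT, IR: finite size at scale + CS clustering
of the canonical scheme — crux (B)'s deliverables in satisfiable currency), `stub_uvPhysics345` (INPUT, UV: uniform-threshold
plaquette-string bounds, ONE Pythagorean rotation, ND2, ND3). Composition: `ContinuumLimitOnTrajectory_of :=
continuumLimitOnTrajectory_of_inputsCS stub_chart stub_volume stub_irPhysicsCS stub_uvPhysics345` — the crux by name.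

Disproof used (`Cruxes/ContinuumLimitOnTrajectory/Disproof.lean`, cdisprove gen 3, RESISTS; no newer cycle): the
load-bearing pair {`β_k → ∞`, `θ > 0`} enters `stub_anatomy` (landed), the inputs, the slab-RP discharge and the two sibling
theorems (`β_k → ∞` is a hypothesis of `stub_uclOfCscl`); §5 `crux_imp_universalRatio` is what the quarantined volume clause
protects; §4 rigidity respected (one canonical `c = a⁻⁴`); §7 necessary condition III (isotropy) is now met by the DISCRETE
input `Rot345` + the landed upgrade; §8 IV′ is the negation of `ND3`. No stub restates a refuted strengthening
(`…WithoutAF`, `sch' := sch`, `∃!T`); the unsatisfiable `TorusOSGap` is gone from every stub.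
-/

open scoped SchwartzMap
open MeasureTheory Filter Topology
open Literature.MathematicalPhysics.QuantumFieldTheory Literature.MathematicalPhysics.QuantumLattice
open Literature.MathematicalPhysics.AQFT Literature.Probability.LatticeModels
open Summit.QuantumFields.YangMills.Theses.ParabolicTrajectory

noncomputable section

namespace Summit.QuantumFields.YangMills.Cruxes.ContinuumLimitOnTrajectory.TwoOrbitSynchronisation

/-! ## §3 Registered stubs (v3.4 statements; `sorry` lives only here) -/

/-- Stub (XL; PROMOTED to the planner, PROMOTE-two-orbit-synchronisation.md — not worked by the line): the two-orbit chart
exists (Bałaban's complete step along Wilson orbits with Lipschitz large-field differences, weak-coupling thermodynamic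
limits at Wilson points, readout pin, exit massiveness). -/
theorem stub_chart : ChartExists := by
  sorry

/-- Stub (QUARANTINED volume clause; the misstatement of (A) as typed — NOT derivable from the crux hypotheses, which
admit arbitrarily slow volume growth `a_k L_k → ∞`; becomes trivial once the planner adds `PolyVolumeGrowth sch` to (A)). -/
theorem stub_volume : VolumeClause := by
  sorry

/-- Stub (IR PHYSICS INPUT in Cauchy–Schwarz currency, open; crux (B)'s deliverables): the rate-free finite-size clause and an
ε-slack Cauchy–Schwarz clustering of the canonical scheme at some physical rate `Δ₁ > 0`, along every sequence of the
hypothesis block with polynomial volume growth. -/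
theorem stub_irPhysicsCS : IRPhysicsCS := by
  sorry

/-- Stub (UV PHYSICS INPUT with discrete rotation restoration, open): uniform-threshold plaquette-string bounds `UUVB`,
asymptotic invariance under ONE Pythagorean rotation `Rot345`, non-degenerate two- and three-point limits `ND2`, `ND3`. -/
theorem stub_uvPhysics345 : UVPhysics345 := by
  sorry

-- LANDED (tree theorems, imported through …Reduction): `stub_sync : TwoOrbitSync` (…StubSync p87541),
-- `stub_anatomy : Anatomy` (…StubAnatomy p87547), `stub_osPackaging : OneFieldOSLegs'` (…StubOSLegsD_Assembly p90720),
-- `stub_axisSymmetry : AxisSymmetry` (p115410), `stub_arp : ARPOfRP` (p116117), `stub_transl : TranslOfUUVB` (p119243),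
-- `stub_uclOfGap : UCLOfGap` (p123780, retired in v3.5 with `TorusOSGap`); DISCHARGED: `TorusSlabRP` (`torusSlabRP_of_tendsto`,
-- …SlabRP p124885); sibling theorems (stmt-15828): `stub_uclOfCscl` p132690, `stub_rotOfPythagorean` p133709;
-- the compositions `Reduction.reduction` (…Reduction p125389, v3.4) and `Reduction.reductionCS` (…Reduction2, v3.5).

/-! ## §4 The checked composition -/

/-- **The reduction statement for the RESTATED crux (v3.6)**: the three physics/chart stub statements imply (A_PVG). -/
def StubsImplyCruxPVG : Prop :=
  ChartExists → IRPhysicsCS → UVPhysics345 → ContinuumLimitOnTrajectoryPVG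

/-- **The three inputs imply the restated crux** — the tree theorem `continuumLimitOnTrajectoryPVG_of_inputs` (…ReductionPVG,
seat c4: `Reduction.reductionPVG` applied to the five landed lattice-kinematics stubs and the two sibling theorems). -/
theorem stubsImplyCruxPVG : StubsImplyCruxPVG :=
  continuumLimitOnTrajectoryPVG_of_inputs

/-- **The restated crux from the registered stubs (v3.6)** — no volume stub: closed modulo `stub_chart` (PROMOTED),
`stub_irPhysicsCS`, `stub_uvPhysics345` (INPUTS). -/
theorem continuumLimitOnTrajectoryPVG_skeleton : ContinuumLimitOnTrajectoryPVG :=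
  continuumLimitOnTrajectoryPVG_of_inputs stub_chart stub_irPhysicsCS stub_uvPhysics345

/-- **The reduction statement (v3.5, kept)**: the four open stub statements imply the crux as typed (by name). -/
def StubsImplyCrux5 : Prop :=
  ChartExists → VolumeClause → IRPhysicsCS → UVPhysics345 → ContinuumLimitOnTrajectory

/-- **The four open stub statements imply the crux** — via the restatement (…DefsF glue + …ReductionPVG; same type as
v3.5's `continuumLimitOnTrajectory_of_inputsCS`, …Reduction2). -/
theorem stubsImplyCrux5 : StubsImplyCrux5 :=
  fun hchart hvol hir huv => continuumLimitOnTrajectory_of_volumeClause hvol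
    (continuumLimitOnTrajectoryPVG_of_inputs hchart hir huv)

/-- **The skeleton: the crux BY NAME from the registered stubs (v3.6)** — the quarantined volume stub + the restated crux. -/
theorem ContinuumLimitOnTrajectory_of : ContinuumLimitOnTrajectory :=
  continuumLimitOnTrajectory_of_volumeClause stub_volume continuumLimitOnTrajectoryPVG_skeleton

/-- **Bonus (CS currency): the same stubs give (A) together with the continuum gap clause of the witness.** -/
theorem continuumLimitWithGap_skeleton : ContinuumLimitWithGap :=
  continuumLimitWithGap_of_volumeClause stub_volume
    (continuumLimitWithGapPVG_of_inputs stub_chart stub_irPhysicsCS stub_uvPhysics345)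

/-! ## §4b The repaired route (seat c5, …DefsG / …RouteRepair): what the same stubs give AFTER the restatement -/

/-- **Repaired assembly, pre-certified**: the restated (A) and (S) with (B) as typed imply `YangMills` (`closesPVG`, pure logic). -/
example : ContinuumLimitOnTrajectoryPVG → LatticeGapOnTrajectory → TunedSequenceExistsPVG → YangMills :=
  closesPVG

/-- **The sub-problem from the registered stubs of the RESTATED crux plus (B) and (S_PVG)** — no volume stub: after the
planner's restatement the route is closed modulo `stub_chart` (PROMOTED), `stub_irPhysicsCS`, `stub_uvPhysics345` (INPUTS),
crux (B) `LatticeGapOnTrajectory` and the repaired (S) `TunedSequenceExistsPVG`. -/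
theorem yangMills_skeletonPVG : LatticeGapOnTrajectory → TunedSequenceExistsPVG → YangMills :=
  yangMills_of_inputsPVG stub_chart stub_irPhysicsCS stub_uvPhysics345

-- Gap currency (reconciled with the (B) chain, tree theorems of …RouteRepair p145719, importable once built on the farm):
--   `yangMills_of_gapCurrency (continuumLimitWithGapPVG_of_inputs stub_chart stub_irPhysicsCS stub_uvPhysics345) :
--      Split.LatticeGapOnTrajectoryLat → TunedSequenceExistsPVG → YangMills`   (no transfer clause of (B) used)
--   `yangMills_of_allInputs stub_chart stub_irPhysicsCS stub_uvPhysics345 hW : TunedSequenceExistsPVG → YangMills`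
--      (hW = the (B) line's orbit–Kantorovich windows along tuned schemes): the whole route from the stubs of BOTH crux lines + (S_PVG).

/-! ## §5 Checks against the landed Negative lemmas (importable `Theorems/…/Negative/`) -/

section NegativeChecks

variable {G : Type} [Group G] [TopologicalSpace G] [IsTopologicalGroup G] [CompactSpace G]
  [MeasurableSpace G] [BorelSpace G]

/-- The `β ≡ 0` (product-Haar, ultralocal) direction cannot meet the tuning hypothesis `N_1 → θ`, `θ > 0`,
which is a hypothesis of `stub_volume`/`stub_irPhysicsCS`/`stub_uvPhysics345` and (in infinite-volume form) of `stub_anatomy`: no stub is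
instantiated in the disprover's junk regime (`LatticeGapOnTrajectory.Negative.not_tuning_of_eventually_zero_coupling`). -/
example (r : LatticeRep G) (sch : SpeciesScheme (YMSpecies G)) {M : ℕ} {n : ℕ → ℕ}
    (hs : ∀ k, sch.a k = ((M : ℝ) ^ n k)⁻¹) (hβ : ∀ᶠ k in atTop, sch.β k = 0) {θ : ℝ} (hθ : 0 < θ) :
    ¬ Tendsto (fun k => ((M : ℝ) ^ n k) ^ 8 *
        latticeConnectedCorr r.ρ (sch.β k) (sch.side k) r.curvature.F r.curvature.F (M ^ n k))
        atTop (𝓝 θ) :=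
  Summit.QuantumFields.YangMills.Theorems.LatticeGapOnTrajectory.Negative.not_tuning_of_eventually_zero_coupling
    r sch hs hβ hθ.ne'

/-- The load-bearing pair {`β_k → ∞`, `θ > 0`} (`Negative.continuumLimitOnTrajectory_false_without_AF`): the
composition honours it — `β_k → ∞` feeds `betaOf_surj` (Wilson couplings exist only for `β_k ≥ B₀`), the slab-RP discharge `torusSlabRP_of_tendsto`, and
`stub_anatomy`'s `betaOf ∘ g → ∞`; `θ > 0` feeds `stub_anatomy` only (floor `g_low`, bounded offset). -/
example := @Summit.QuantumFields.YangMills.Theorems.ContinuumLimitOnTrajectory.Negative.continuumLimitOnTrajectory_false_without_AF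

/-- Necessary condition II (universality of kernel ratios across equally tuned sequences,
`Negative.continuumLimitOnTrajectory_imp_universalRatio`) is a THEOREM about the crux; in this line it is met by
`continuousOn_expect` + `pin` (two equally tuned sequences have interleavable, hence jointly Cauchy, terminal
chart points), not contradicted. -/
example (h : ContinuumLimitOnTrajectory) :=
  Summit.QuantumFields.YangMills.Theorems.ContinuumLimitOnTrajectory.Negative.continuumLimitOnTrajectory_imp_universalRatio h

/-- Necessary condition III (isotropy of kernel ratios, `…_imp_isotropicRatio`) = the E1 clause `AsympEuclid`
of `stub_uvPhysics345` (`Rot345` upgraded to `AsympRot` by `stub_rotOfPythagorean`; the translation half is PROVED, `stub_transl`); necessary condition IV (skewness ratios converge, `…_imp_skewnessRatio`) is implied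
by `ConvProducts`; its strengthening IV′ (all skewness limits vanish) is the negation of `ND3`. -/
example (h : ContinuumLimitOnTrajectory) :=
  Summit.QuantumFields.YangMills.Theorems.ContinuumLimitOnTrajectory.Negative.continuumLimitOnTrajectory_imp_isotropicRatio h

end NegativeChecks

end Summit.QuantumFields.YangMills.Cruxes.ContinuumLimitOnTrajectory.TwoOrbitSynchronisation

end
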